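import Summits.Ventures.YMGap.RobustBall.CentreBlindBallWindow
import Summits.Ventures.YMGap.RobustBall.ResponseFluctuation
import Summits.Ventures.YMGap.RobustBall.SpecificHeatFluctuation
import Summits.Ventures.YMGap.RobustBall.FreeEnergyCurvatureCeilingBall
import Summits.Ventures.YMGap.RobustBall.TorusStateLipschitzBall
import HarnessLib

/-!
# Venture statement — YMGap (cell `pub-ymgap`) — CONJUNCT BODIES T65c, T75 (= T75a–c), T76 (= T76a,b) (V23E, block 1)

STATUS: FILED by p3 g10 as V23E = T65c + T75 (= T75a–c) + T76 (= T76a,b) on the chair's ★ V23E YES lines (procedural under ★ R322 (4) / ★ R324 (4), no new R-number): lead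
g11, bus 2026-08-24T19:12:40Z, INBOX l.6343, quoted: «V23E (p3 l.6341): YES — `StatementConjunctsV23E.lean` = T65c_CentreBlindBall (lead number of R294 kept …) + ANY set
that turns GREEN-by-import before your final-sha line, numbered T75+ in GREEN order and announced FIRST …»; lead g12, bus 2026-08-24T20:31:19Z, INBOX l.6473 (B), quoted:
«V23E: YES — `StatementConjunctsV23E.lean` = candidate b084f378362e307d (278 l) = T65c_CentreBlindBall + T75a_SU2FluctuationResponse / T75b_SU2SpecificHeatFluctuation /
T75c_SU2EnergyDensityAlmostSure + `T75_SU2FluctuationDissipation` + T76a_BallNoFirstOrderTransition / T76b_BallTorusStateLipschitz + `T76_BallThermodynamicRegularity`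
(numbers T75/T76 = p3's in GREEN order ✓; next free T77); referee F-629 pre-audit CLEAN … FILE at or after 21:00Z absent owner corrections (ds-3 g16 for T75, rb-p2 g12
for T76 — silence = consent …) … a set turning GREEN after your final-sha line goes to the NEXT block (V23F)». Owner consents: ds-4 g12 NO-OBJECTION bus l.6113 (T65c);
ds-3 and rb-p2: no correction by the 21:00Z window (silence = consent). Referee pre-audits: F-612 (T65c-only candidate 275f0f7f6c58ca18) and F-629 (grown candidate
b084f378362e307d: mono 16/16 std, provenance 33/33 + 42/42 + 55/55). Number T65c by the lead (R294 l.4477 «T65 ds-4 centre tube family»; T65a,b landed in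
`StatementConjunctsV22C` e1fb0f1519d9; ★ R322 (4) / ★ R324 (4): «T65c joins the first section of the next block iff `CentreBlindBallWindow.olean` is in the hub store
before the final-sha line»); numbers T75, T76 assigned by p3 under lead g10's delegation (bus 2026-08-24T09:03:51Z; ★ R324 (4) «next free number T75 (p3's)») in GREEN
order = order of the owners' READY lines, announced on the bus before filing. GREEN = parents are TREE modules with built oleans and the owner file answers a by-import
`lean check` rc 0 / 0 warnings / std axioms: T65c — `RobustBall/CentreBlindBallWindow` (ds-4 p381975, tree bytes d00382a6cee91066, olean ctime 18:52:26Z 2026-08-24),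
owner file ds-4 g10 `HOME/ds/ds4/lean/ball/V22ConjunctDS4g10.lean` 1f98dbb416b084be rc 0 at 19:07Z (owner countersign in its header; NO-OBJECTION ds-4 g12 bus l.6113);
T75 — ds-3 g14 part C `HOME/ds/ds3/lean/g14/texts/V1XConjunctsDS3g14C.lean` 1ed7a1da37a5e5ae (parents `RobustBall/ResponseFluctuation` olean 18:52:26Z,
`RobustBall/SpecificHeatFluctuation` olean 20:06:03Z; owner READY line bus l.6051) rc 0 at 20:17Z; T76 — rb-p2 g9 split copy `HOME/rb/lean-rb-p2/T-texts-rbp2g9-P2.lean`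
c9d12a8a7b6cb88b (parents `RobustBall/FreeEnergyCurvatureCeilingBall` olean 20:06:03Z, `RobustBall/TorusStateLipschitzBall` olean 18:46:24Z; owner pointer bus l.6073) rc
0 at 20:17Z. Only decl names change (map `RENAMES-V23E.txt`: `T65c_CentreBlindBall ↦ T65c_CentreBlindBall` — a number-letter of the T65 family, no consolidator; `T_X ↦
T75x_X` / `T76x_X` with p3's consolidating conjunctions `T75_SU2FluctuationDissipation`, `T76_BallThermodynamicRegularity` in the V20B/V22/V23 style, not owner bytes);
ONE line `open Summit.Ventures.YMGap.RobustBall` is added in the rb-p2 section (the owner file declares inside `namespace …RobustBall`, which the block format strips);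
built mechanically by `mkmono23e.py`; byte-compare `bytecmp.py --map` = verbatim-modulo-map. NOT IN THIS BLOCK unless GREEN before the final-sha line (numbers T77+ are
p3's): ds-3 g14 parts A / D–F, ds-1 g11 B, ds-1 g10 C3/C4, ds-4 g11/g12 b–d, rb-p2 g8 (T67a–d/T68a keep the lead's numbers) / g9 rest / g10 / g11, rb-p1 g7/g8
`T_O`–`T_Z`.

HONEST FRAMING. WHAT THIS IS: bodies `Tk_… : Prop` + witnesses `Tk_…_holds`, kernel-checked with NO hypothesis, closing by TREE constants only. STRONG-COUPLING
LATTICE statements. (T65c) THE CENTRE-BLIND BALL WINDOW, `SU(2)`, `d = 4` — Wilson's area law `AreaLawCentreBlind 2 4 β` with ONE `(C, c)` on every torus for EVERY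
linkwise centre-blind perturbation (any size / range / strength) whenever `tanh(2|β|) ≤ 23/120` (tree coupling `β = β_W/2`; `β_W ≤ artanh(23/120) = 0.194067…`), the
clean row `tanh(2|β|) ≤ 4/21`, the cells `β_W = 0.19` and `0.194`, and the certificate's exact core number (a kernel-evaluated 128-term integer sum for the free Ising
model on the radius-2 ball of `ℤ³`); centre-blind class only (no tube); the rung is exhausted at `β_W ≈ 0.1942`. (T75) FLUCTUATION–RESPONSE for `SU(2)` on `ℤ⁴`
inside the vertex-star window `0 < β_W < 9/25`: the derivative of the plaquette expectation along any DLR selection equals the susceptibility (response =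
fluctuation), the lattice specific heat `¼ f″` IS the thermodynamic fluctuation density of the energy in the unique state, and the empirical energy density over
cubes converges almost surely to the internal energy density — window statements, no size or sign claim on `f″` beyond the tree's, not a CLT. (T76) NO FIRST-ORDER
TRANSITION ON THE TIER-1 TORUS BALL INSIDE THE DOOR: every pointwise thermodynamic limit of member free energies under `TorusClusteringOnBallUpTo` is DIFFERENTIABLE
inside the door with the member energy densities converging to `−f′`, plus the Lipschitz dependence of torus states on the coupling on the ball; `SU(2)` `d = 4` lead
cell `(1/8, 0.223)` hypothesis-free on `(0, 1/16)` — differentiability only (no kink / latent heat), not `C²`, not analyticity, no existence claim for the limits.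
Every window / radius is where a one-link or Dobrushin-type BOUND closes (door artefacts), not a physical transition. WHAT THIS IS NOT: nothing at the crossover
couplings, no continuum limit, no physical-units mass gap, nothing about the Yang–Mills Millennium problem.
-/

noncomputable section

namespace Summit.Ventures.YMGap

/-! ### OWNER FILE `owners/V22ConjunctDS4g10.lean` (sha16 1f98dbb416b084be) — section `V23E_ds4_CentreBlindBall` -/
section V23E_ds4_CentreBlindBall

/-!
Statement v1.x candidate conjunct from ds-4's gen-10 files (TEXT for the p3 / p2 pre-stage — lead R294 reserved number T65; checkable against the tree
once `RobustBall/IsingBallB2` (ACCEPTED f418cd019b56), `IsingBallB2Bound`, `IsingBallB2Embed`, `IsingBallB2Layer`, `CentreBlindBallWindow` are IN THE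
TREE with commits; NOT proposed by ds-4).  ONE conjunct: `T65c_CentreBlindBall`.  Numbering / naming is p3's / the lead's.  Y2 ROBUST-BALL §6(c): THE BALL
WINDOW = RUNG 3 of the β-ladder for the centre-blind class (rung 1 = T13C, 6β_W < 1; rung 2 = T_CentreBlindStar, 30 tanh²β_W < 1): `SU(2)`, `d = 4`,
`AreaLawCentreBlind 2 4 β` for every tree coupling with `tanh(2|β|) ≤ 23/120` (`β_W ≤ artanh(23/120) = 0.194067…`), the clean row `tanh(2|β|) ≤ 4/21`,
the cells `β_W = 0.19` and `β_W = 0.194`, and the EXACT CORE NUMBER of the certificate (a kernel computation).  Relation to T_CentreBlindStar: strictly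
larger window in `d = 4` (`0.18463 → 0.19407`); `d = 3` untouched.
OWNER COUNTERSIGN (ds-4 g10): these bytes are the text of record from this seat; p3 may rename / renumber / fold the opens, bodies unchanged.
-/


section T65sec

open Summit.Ventures.YMGap.RobustBall
open Literature.Probability.LatticeModels (isingTwoPoint BoundaryCondition)

/-- **T65c_CentreBlindBall — track Y2 (seat ds-4 g10): THE BALL WINDOW (RUNG 3 OF THE β-LADDER) FOR THE CENTRE-BLIND CLASS** — `SU(2)`, `d = 4`:
(i) whenever `tanh(2|β|) ≤ 23/120` (`β = β_W/2` the tree coupling; `β_W ≤ artanh(23/120) = 0.194067…`), `AreaLawCentreBlind 2 4 β` — Wilson's area law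
`|⟨W_{R×T}⟩_{β,W,L}| ≤ C^{2(R+T)} e^{−cRT}` with ONE `(C, c)` on every torus for EVERY linkwise centre-blind perturbation `W` (any size / range: adjoint,
mixed fundamental–adjoint actions of any strength, …) (`RobustBall.su2_areaLawCentreBlind_ball2_sharp`); (ii) the clean row `tanh(2|β|) ≤ 4/21 →
AreaLawCentreBlind 2 4 β` (`β_W ≤ 0.192831…`; `RobustBall.su2_areaLawCentreBlind_ball2`); (iii) CELLS `AreaLawCentreBlind 2 4 (19/200)` (`β_W = 0.19`)
and `AreaLawCentreBlind 2 4 (97/1000)` (`β_W = 0.194`; the window of rung 2 ended at `0.18463`, of rung 1 at `1/6`); (iv) THE CERTIFICATE'S CORE NUMBER: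
`∑_{k,s} ⟨σ_0 σ_{±e_k}⟩^∅_{B₂; artanh(4/21)} = 798142860945322720752737108351832962153472 / 604781407537015484375897954513554089641088` for the free
Ising model on the radius-2 ball `B₂` of `ℤ³` (`RobustBall.sum_isingTwoPoint_centre_mid_eq`; a 128-term integer sum evaluated by the kernel).
MECHANISM: centre projection + block conditioning reduce the loop to two-point functions of the `ℤ₂` layer = an Ising model with couplings `|J| ≤ β_W` on
the layer graph, bounded by the ferromagnet (Griffiths); the Simon–Lieb inequality (Duminil-Copin–Tassion 2016, Lemma 2.7, random-current proof in the
tree) with the `ℓ¹`-BALLS OF RADIUS 2 of the three-dimensional layer as sets, whose certificate `φ_β(B₂) ≤ 0.998581 < 1` on `[0, artanh(23/120)]` is an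
exact finite computation (high-temperature reduction of the 25-site ball to a 7-spin core, heat bath at the 18 boundary sites, Griffiths monotonicity
in `β`, transport of the ball into the layer graph for `L ≥ 6`).  HONEST LABEL: `SU(2)` and `d = 4` only; centre-blind class only (no tube); the
ladder's ceiling is `β_c(ℤ³ Ising) ≈ 0.2217` and the class deconfines only at the `ℤ₂`-gauge transition `≈ 0.44`; the root of `φ(B₂) = 1` is
`β_W ≈ 0.1942`, so rung 3 is exhausted; rate a door artefact; strong-coupling lattice statement; nothing continuum / spectral / Clay.
Texts: seat ds-4 (g10). -/
def T65c_CentreBlindBall : Prop :=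
  (∀ β : ℝ, Real.tanh (2 * |β|) ≤ 23 / 120 → AreaLawCentreBlind 2 4 β) ∧
  (∀ β : ℝ, Real.tanh (2 * |β|) ≤ 4 / 21 → AreaLawCentreBlind 2 4 β) ∧
  (AreaLawCentreBlind 2 4 (19 / 200) ∧ AreaLawCentreBlind 2 4 (97 / 1000)) ∧
  (∑ ks : Fin 3 × Bool, isingTwoPoint b2Graph Finset.univ b2Beta 0 BoundaryCondition.free B2V.centre (B2V.mid ks.1 ks.2) =
    798142860945322720752737108351832962153472 / 604781407537015484375897954513554089641088)

/-- T65c_CentreBlindBall holds (`RobustBall.su2_areaLawCentreBlind_ball2_sharp`, `…_ball2`, `…_ball2_cell`, `…_ball2_cell_sharpest`,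
`RobustBall.sum_isingTwoPoint_centre_mid_eq`; seat ds-4 g10 text). -/
theorem T65c_CentreBlindBall_holds : T65c_CentreBlindBall :=
  ⟨fun _ h => su2_areaLawCentreBlind_ball2_sharp h, fun _ h => su2_areaLawCentreBlind_ball2 h,
    ⟨su2_areaLawCentreBlind_ball2_cell, su2_areaLawCentreBlind_ball2_cell_sharpest⟩, sum_isingTwoPoint_centre_mid_eq⟩

end T65sec

end V23E_ds4_CentreBlindBall

/-! ### OWNER FILE `owners/V1XConjunctsDS3g14C.lean` (sha16 1ed7a1da37a5e5ae) — section `V23E_ds3_FluctuationResponse` -/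
section V23E_ds3_FluctuationResponse

/-!
Statement v1.x candidate conjuncts from ds-3's gen-14 files, PART C (TEXT for the p2/p3 seats; checkable once `ResponseFluctuation.lean`
and `SpecificHeatFluctuation.lean` (+ parents `ThermodynamicVariance`, `ErgodicAverages`) are IN THE TREE with oleans BUILT; NOT proposed by
ds-3). Y2 ROBUST-BALL, currencies C-RESP (fluctuation–response) and C-CV (specific heat = energy fluctuation density). HONEST LABEL: lattice
statements for the unique infinite-volume DLR state of `SU(2)` on `ℤ⁴` in the vertex-star window `0 < β_W < 9/25`; built on ds-1's C-DIFF
identities; not a CLT; nothing continuum, nothing at the Y3 couplings.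
-/

open MeasureTheory Filter Topology ProbabilityTheory Set
open scoped NNReal
open Literature.Probability.LatticeModels hiding configShift configShift_apply
open Literature.MathematicalPhysics.QuantumLattice (fundamentalRep ZdEdge LGConfig ymGibbsMeasures configShift freeEnergyDensity)
open Literature.MathematicalPhysics.QuantumFieldTheory (IsLipschitzCylinder zdPlaquetteObs)
open Summit.Ventures.YMGap
open Summit.Ventures.YMGap.RobustBall

/-- **T75a_SU2FluctuationResponse — `SU(2)` ON `ℤ⁴`, `0 < β_W < 9/25`**: for ANY DLR selection `μ(·)` (`μ β_W ∈ 𝒢(β_W/2)` tree coupling, all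
`β_W`) and every Lipschitz cylinder observable `F` with nonempty link set and `|F| ≤ 1`:
`Cov_{μ β_W}(Σ_{x∈B_n} F∘θ_x, Σ_{x∈B_n} e∘θ_x)/#B_n → d/dβ_W ⟨F⟩_{μ β_W}`, `e = Σ_{i<j} W_{(0;i,j)}` the plaquette energy density,
`B_n = siteBox 4 n` (`ResponseFluctuation.su2_response_eq_lim_covariance_density`). -/
def T75a_SU2FluctuationResponse : Prop :=
  ∀ (μ : ℝ → Measure (LGConfig 4 (Matrix.specialUnitaryGroup (Fin 2) ℂ))),
    (∀ βW : ℝ, μ βW ∈ ymGibbsMeasures (d := 4) (fundamentalRep (Fin 2)) (2 * (βW / 4))) →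
    ∀ (F : LGConfig 4 (Matrix.specialUnitaryGroup (Fin 2) ℂ) → ℝ) (Λ : Finset (ZdEdge 4)) (K : ℝ≥0),
      IsLipschitzCylinder (fundamentalRep (Fin 2)) F Λ K → Λ.Nonempty → (∀ U, |F U| ≤ 1) →
    ∀ βW : ℝ, βW ∈ Ioo (0 : ℝ) (9 / 25) →
      Tendsto (fun n : ℕ => cov[fun U => ∑ x ∈ siteBox 4 n, F (configShift x U),
          fun U => ∑ x ∈ siteBox 4 n, ∑ q : {q : Fin 4 × Fin 4 // q.1 < q.2},
            zdPlaquetteObs (fundamentalRep (Fin 2)) 0 q.1.1 q.1.2 (configShift x U); μ βW] / (siteBox 4 n).card) atTop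
        (𝓝 (deriv (fun t => ∫ U, F U ∂(μ t)) βW))

/-- T75a_SU2FluctuationResponse holds. -/
theorem T75a_SU2FluctuationResponse_holds : T75a_SU2FluctuationResponse :=
  fun _ hμ _ _ _ hF hΛ hF1 _ hb => ResponseFluctuation.su2_response_eq_lim_covariance_density hμ hF hΛ hF1 hb

/-- **T75b_SU2SpecificHeatFluctuation — `SU(2)` ON `ℤ⁴`, `0 < b < 9/50`** (tree coupling; `0 < β_W < 9/25`): the DLR states form a singleton `{ν}`
and `Var_ν(Σ_{x∈B_n} e∘θ_x)/#B_n → ¼ · f''(b)` with `e = Σ_{i<j} W_{(0;i,j)}` and `f` the tree's `freeEnergyDensity 4 (fundamentalRep (Fin 2))`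
(`SpecificHeat.su2_tendsto_variance_energy_boxSum_div`). -/
def T75b_SU2SpecificHeatFluctuation : Prop :=
  ∀ b : ℝ, b ∈ Ioo (0 : ℝ) (9 / 50) →
    ∃ ν : Measure (LGConfig 4 (Matrix.specialUnitaryGroup (Fin 2) ℂ)),
      ymGibbsMeasures (d := 4) (fundamentalRep (Fin 2)) b = {ν} ∧
      Tendsto (fun n : ℕ => Var[fun U => ∑ x ∈ siteBox 4 n, ∑ q : {q : Fin 4 × Fin 4 // q.1 < q.2},
          zdPlaquetteObs (fundamentalRep (Fin 2)) 0 q.1.1 q.1.2 (configShift x U); ν] / (siteBox 4 n).card) atTop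
        (𝓝 ((1 / 4 : ℝ) * deriv (deriv (freeEnergyDensity 4 (fundamentalRep (Fin 2)))) b))

/-- T75b_SU2SpecificHeatFluctuation holds. -/
theorem T75b_SU2SpecificHeatFluctuation_holds : T75b_SU2SpecificHeatFluctuation :=
  fun _ hb => SpecificHeat.su2_tendsto_variance_energy_boxSum_div hb

/-- **T75c_SU2EnergyDensityAlmostSure — `SU(2)` ON `ℤ⁴`, `0 < b < 9/50`**: the DLR states form a singleton `{ν}` and for `ν`-almost every
configuration `U` the empirical energy density over the cubes converges: `#B_n⁻¹ Σ_{x∈B_n} e(θ_x U) → 6 + ½ f'(b)`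
(`SpecificHeat.su2_ae_tendsto_energy_boxAverage`). -/
def T75c_SU2EnergyDensityAlmostSure : Prop :=
  ∀ b : ℝ, b ∈ Ioo (0 : ℝ) (9 / 50) →
    ∃ ν : Measure (LGConfig 4 (Matrix.specialUnitaryGroup (Fin 2) ℂ)),
      ymGibbsMeasures (d := 4) (fundamentalRep (Fin 2)) b = {ν} ∧
      ∀ᵐ U ∂ν, Tendsto (fun n : ℕ => (∑ x ∈ siteBox 4 n, ∑ q : {q : Fin 4 × Fin 4 // q.1 < q.2},
          zdPlaquetteObs (fundamentalRep (Fin 2)) 0 q.1.1 q.1.2 (configShift x U)) / (siteBox 4 n).card) atTop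
        (𝓝 (6 + (1 / 2 : ℝ) * deriv (freeEnergyDensity 4 (fundamentalRep (Fin 2))) b))

/-- T75c_SU2EnergyDensityAlmostSure holds. -/
theorem T75c_SU2EnergyDensityAlmostSure_holds : T75c_SU2EnergyDensityAlmostSure :=
  fun _ hb => SpecificHeat.su2_ae_tendsto_energy_boxAverage hb

end V23E_ds3_FluctuationResponse

/-! ### OWNER FILE `owners/T-texts-rbp2g9-P2.lean` (sha16 c9d12a8a7b6cb88b) — section `V23E_rbp2_BallThermodynamics` -/
section V23E_rbp2_BallThermodynamics

open Summit.Ventures.YMGap.RobustBall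

/-!
# Venture YMGap — two of rb-p2 g9's candidate statement conjuncts, SPLIT COPY importing only LANDED files (rb-p2 g11 for p3)

HONEST FRAMING: verbatim copies of `T76a_BallNoFirstOrderTransition` (★★★ NO FIRST-ORDER TRANSITION on the tier-1 torus ball inside the door;
`RobustBall/FreeEnergyCurvatureCeilingBall.lean` p382391 9664c0797792) and `T76b_BallTorusStateLipschitz` (★★ C-LIP on the torus ball;
`RobustBall/TorusStateLipschitzBall.lean` p378869 e6adc4f8b661) from `T-texts-rbp2g9.lean` 8df9def8208d3382, whose other four candidates wait for
unlanded parents.  LATTICE statements inside the Dobrushin door; nothing continuum / Clay.  DRAFT for p3 / rb-theory; not proposed by rb-p2.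
-/


open MeasureTheory ProbabilityTheory Filter Topology Finset Set
open Literature.Probability.LatticeModels hiding Site
open Literature.MathematicalPhysics.QuantumLattice hiding torusNorm
open Literature.MathematicalPhysics.QuantumFieldTheory hiding ZdEdge
open Summit.Ventures.YMGap.RobustBall.EnergyVariance


/-- ★★★ **T76a_BallNoFirstOrderTransition** (seat rb-p2 g9; `RobustBall/FreeEnergyCurvatureBall.lean`): NO FIRST-ORDER TRANSITION ON THE BALL INSIDE
THE DOOR.  `d ≥ 1`, the ball `ClusterDomainFR ε₀ ε₁ r` carrying ds-2's currency `TorusClusteringOnBallUpTo N d βs ε₀ ε₁ r A m` (`A ≥ 0`,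
`m > 0`): every pointwise limit `f` on `[0, βs]` of member pressures `L_n^{−d} log Z_{Λ_{L_n},t,W_n}` (volumes `L_n ≥ 3`, any
members `W_n`) is DIFFERENTIABLE at every `x ∈ (0, βs)` and the finite-volume energy densities `L_n^{−d}⟨S_W⟩_{x,W_n}` converge to `−f′(x)` there
(no exceptional set); `SU(2)`, `d = 4`, lead cell `(β_W, ε) = (1/8, 0.223)` hypothesis-free on `(0, 1/16)`
(tree coupling).  HONEST LABEL: lattice; inside the robust door only; differentiability (no kink / no latent heat in the coupling direction),
not `C²` or analyticity; no existence claim for the limits; nothing about the continuum or Clay. -/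
def T76a_BallNoFirstOrderTransition : Prop :=
  (∀ (d N : ℕ), 1 ≤ d → ∀ (βs ε₀ ε₁ A m : ℝ) (r : ℕ), TorusClusteringOnBallUpTo N d βs ε₀ ε₁ r A m → 0 ≤ A → 0 < m →
      ∀ (Ls : ℕ → ℕ) [∀ n, NeZero (Ls n)], (∀ n, 3 ≤ Ls n) →
        ∀ (Ws : (n : ℕ) → Perturbation d (Ls n) N), (∀ n, Ws n ∈ ClusterDomainFR ε₀ ε₁ r) → ∀ (f : ℝ → ℝ),
          (∀ t ∈ Set.Icc 0 βs, Tendsto (fun n => (((Ls n) : ℝ) ^ d)⁻¹ *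
              Real.log ((Ws n).partitionFunction (fundamentalRep (Fin N)) t).toReal) atTop (𝓝 (f t))) →
            ∀ x ∈ Set.Ioo 0 βs, DifferentiableAt ℝ f x) ∧
  (∀ (d N : ℕ), 1 ≤ d → ∀ (βs ε₀ ε₁ A m : ℝ) (r : ℕ), TorusClusteringOnBallUpTo N d βs ε₀ ε₁ r A m → 0 ≤ A → 0 < m →
      ∀ (Ls : ℕ → ℕ) [∀ n, NeZero (Ls n)], (∀ n, 3 ≤ Ls n) →
        ∀ (Ws : (n : ℕ) → Perturbation d (Ls n) N), (∀ n, Ws n ∈ ClusterDomainFR ε₀ ε₁ r) → ∀ (f : ℝ → ℝ),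
          (∀ t ∈ Set.Icc 0 βs, Tendsto (fun n => (((Ls n) : ℝ) ^ d)⁻¹ *
              Real.log ((Ws n).partitionFunction (fundamentalRep (Fin N)) t).toReal) atTop (𝓝 (f t))) →
            ∀ x ∈ Set.Ioo 0 βs, Tendsto (fun n => (((Ls n) : ℝ) ^ d)⁻¹ *
              ∫ U, wilsonAction (fundamentalRep (Fin N)) U ∂(Ws n).perturbedMeasure (fundamentalRep (Fin N)) x) atTop (𝓝 (-deriv f x))) ∧
  (∀ (r : ℕ) (Ls : ℕ → ℕ) [∀ n, NeZero (Ls n)], (∀ n, 3 ≤ Ls n) →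
      ∀ (Ws : (n : ℕ) → Perturbation 4 (Ls n) 2), (∀ n, Ws n ∈ ClusterDomainFR (223 / 500) (223 / 1000) r) → ∀ (f : ℝ → ℝ),
        (∀ t ∈ Set.Icc (0 : ℝ) (1 / 16), Tendsto (fun n => (((Ls n) : ℝ) ^ 4)⁻¹ *
            Real.log ((Ws n).partitionFunction (fundamentalRep (Fin 2)) t).toReal) atTop (𝓝 (f t))) →
          ∀ x ∈ Set.Ioo (0 : ℝ) (1 / 16), DifferentiableAt ℝ f x)

/-- T76a_BallNoFirstOrderTransition holds (`differentiableAt_of_tendsto_memberPressure`, `su2_differentiableAt_limit_oneEighth`). -/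
theorem T76a_BallNoFirstOrderTransition_holds : T76a_BallNoFirstOrderTransition :=
  ⟨fun _ _ hd _ _ _ _ _ _ h hA hm _ _ hLs3 _ hWs _ hlim _ hx =>
      differentiableAt_of_tendsto_memberPressure hd h hA hm hLs3 hWs hlim hx,
    fun _ _ hd _ _ _ _ _ _ h hA hm _ _ hLs3 _ hWs _ hlim _ hx =>
      tendsto_memberEnergyDensity hd h hA hm hLs3 hWs hlim hx,
    fun r _ _ hLs3 _ hWs _ hlim _ hx => su2_differentiableAt_limit_oneEighth r hLs3 hWs hlim hx⟩

/-- ★★ **T76b_BallTorusStateLipschitz** (seat rb-p2 g9; `RobustBall/TorusStateLipschitzBall.lean`): C-LIP ON THE TORUS BALL INSIDE THE DOOR.  `d ≥ 1`: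
if a member `W` of the torus ball clusters with `(A, m)` (`A ≥ 0`, `m > 0`) at every coupling of `[lo, hi]` (ds-2's `ClustersWith`), then for every
bounded measurable local observable `F` (links `Δ` based within torus distance `D` of `x₀`, `suFrobDist`-Lipschitz vector `δ`) and all `s, t ∈ [lo, hi]`:
`|⟨F⟩_{Λ_L,t,W} − ⟨F⟩_{Λ_L,s,W}| ≤ (A·4√N·(Σ_Δ δ)·e^{m(D+1)}·#orient·((1+e^{−m/d})/(1−e^{−m/d}))^d)·|t − s|` — one constant for every volume and
every member with these clustering constants (Feynman–Hellmann `d/dt⟨F⟩ = −Cov(F, S_W)` + the torus susceptibility bound).  HONEST LABEL: lattice,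
finite volume, inside the door; Dobrushin constants; nothing about the continuum or Clay. -/
def T76b_BallTorusStateLipschitz : Prop :=
  ∀ (d N L : ℕ) [NeZero L], 1 ≤ d → ∀ (W : Perturbation d L N) (A m lo hi : ℝ), 0 ≤ A → 0 < m →
    (∀ t ∈ Set.Icc lo hi, ClustersWith W t A m) → ∀ (F : GaugeConfig d L (SUN N) → ℝ), Measurable F →
      ∀ (Δ : Finset (Edge d L)), DependsOn F (↑Δ : Set (Edge d L)) → ∀ (M : ℝ), (∀ U, |F U| ≤ M) →
        ∀ (δ : Edge d L → ℝ), Literature.Probability.LatticeModels.DobrushinMetric.IsLipBound suFrobDist F δ →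
          ∀ (x₀ : Literature.MathematicalPhysics.QuantumFieldTheory.Site d L) (D : ℕ), (∀ x ∈ Δ, torusNorm (x.1 - x₀) ≤ D) →
            ∀ (s t : ℝ), s ∈ Set.Icc lo hi → t ∈ Set.Icc lo hi →
              |∫ U, F U ∂W.perturbedMeasure (fundamentalRep (Fin N)) t - ∫ U, F U ∂W.perturbedMeasure (fundamentalRep (Fin N)) s| ≤
                (A * (4 * Real.sqrt N) * (∑ x ∈ Δ, δ x) * Real.exp (m * (D + 1)) *
                    ((Fintype.card {ij : Fin d × Fin d // ij.1 < ij.2} : ℝ) * ((1 + Real.exp (-(m / d))) / (1 - Real.exp (-(m / d)))) ^ d)) *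
                  |t - s|

/-- T76b_BallTorusStateLipschitz holds (`abs_memberExpectation_sub_le`). -/
theorem T76b_BallTorusStateLipschitz_holds : T76b_BallTorusStateLipschitz :=
  fun _ _ _ _ hd _ _ _ _ _ hA hm hW _ hFm _ hFdep _ hFb _ hFlip _ _ hD _ _ hs ht =>
    abs_memberExpectation_sub_le hd hA hm hW hFm hFdep hFb hFlip hD hs ht



end V23E_rbp2_BallThermodynamics

/-! ### DEFAULT GROUPING (p2): one consolidating conjunction per owner file — `G_<tag> := T_a ∧ T_b ∧ …` + `_holds`.
The lead composes V23E by theme; p3 renames `G_<tag> ↦ T<k>_<Name>` (via --map) or regroups at will; these are additions, not owner bytes. -/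
section V23E_groups

/-- Default group for section `V23E_ds3_FluctuationResponse`: the conjunction of its 3 owner texts. -/
def T75_SU2FluctuationDissipation : Prop :=
  T75a_SU2FluctuationResponse ∧ T75b_SU2SpecificHeatFluctuation ∧ T75c_SU2EnergyDensityAlmostSure

/-- `T75_SU2FluctuationDissipation` holds (componentwise by the owners' `_holds`). -/
theorem T75_SU2FluctuationDissipation_holds : T75_SU2FluctuationDissipation :=
  ⟨T75a_SU2FluctuationResponse_holds, T75b_SU2SpecificHeatFluctuation_holds, T75c_SU2EnergyDensityAlmostSure_holds⟩

/-- Default group for section `V23E_rbp2_BallThermodynamics`: the conjunction of its 2 owner texts. -/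
def T76_BallThermodynamicRegularity : Prop :=
  T76a_BallNoFirstOrderTransition ∧ T76b_BallTorusStateLipschitz

/-- `T76_BallThermodynamicRegularity` holds (componentwise by the owners' `_holds`). -/
theorem T76_BallThermodynamicRegularity_holds : T76_BallThermodynamicRegularity :=
  ⟨T76a_BallNoFirstOrderTransition_holds, T76b_BallTorusStateLipschitz_holds⟩

end V23E_groups

end Summit.Ventures.YMGap

end
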